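import Summits.Ventures.Crystal3D.StickySpheres.GraphStratum
import Mathlib.Combinatorics.SimpleGraph.DegreeSum
import Mathlib.Logic.Equiv.Fin.Basic
import Mathlib.Logic.Equiv.Option
import Mathlib.Data.Fin.SuccPred
import HarnessLib

/-!
# One-vertex extensions ("cone graphs") and vertex deletion: the combinatorics of Lemma R6

Venture `Crystal3D` (cell `pub-crystal3d`, seat p3), companion of `GraphStratum.lean` (seat p2: Lemma R5 and the
soundness of the deletion-lookup decider). This file is PURE GRAPH THEORY — nothing about packings:

* `coneGraph p K S` — the graph on `Fin (n + 1)` obtained from a graph `K` on `Fin n` by inserting a NEW vertex at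
  position `p` (old vertex `i` sits at `p.succAbove i`) joined to exactly the old vertices in `S`. This is the
  operation `Ext(· ⊕ d)` (`d = |S|`) of the cell's `paper/REDUCTIONS.md`, Addenda 3–4 (Lemma R6) and PLAN R31/R32.
* adjacency lemmas, `comap_coneGraph_succAbove` (deleting the new vertex gives back `K`), the degree and edge-count
  formulas `degree_coneGraph_self = |S|`, `degree_coneGraph_succAbove = deg_K + [· ∈ S]`,
  `card_edgeFinset_coneGraph = |E(K)| + |S|`;
* `isoConeGraph` — EVERY graph `G` on `Fin (n + 1)` is, for every vertex `p`, isomorphic to the cone over its own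
  vertex-deleted graph `G.comap p.succAbove` (relabelled along any isomorphism `φ` onto a listed graph `H`, new
  vertex placed anywhere): `G ≃g coneGraph q H (φ '' N(p))`;
* the deletion formulas `degree_comap_succAbove_add` (each remaining vertex loses at most one edge) and
  `card_edgeFinset_comap_succAbove_add_degree` (`|E(G − p)| + deg p = |E(G)|`).

HONEST FRAMING: elementary, [folklore]; used by `ExtensionStep.lean` to make the cell's extension certificates
(T(12)/T(13) chains) statements about named complete-list hypotheses. No claim about contact numbers here.
-/

namespace Summit.Ventures.Crystal3D

open Finset SimpleGraph

/-! ### 1. The cone over a graph, on `Option V` -/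

section Opt

variable {V : Type*}

/-- The one-vertex extension of `K` by a new vertex `none` joined exactly to `S`, as a graph on `Option V`
(`K` on the `some` vertices). [folklore] -/
def coneOpt (K : SimpleGraph V) (S : Finset V) : SimpleGraph (Option V) where
  Adj a b :=
    match a, b with
    | some i, some j => K.Adj i j
    | none, some j => j ∈ S
    | some i, none => i ∈ S
    | none, none => False
  symm := ⟨by
    rintro (_ | a) (_ | b) h
    · exact h
    · exact h
    · exact h
    · exact K.adj_symm h⟩
  loopless := ⟨by
    rintro (_ | a) h
    · exact h
    · exact K.irrefl h⟩

/-- Decidability of adjacency in `coneOpt`. -/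
instance coneOpt.decidableRel (K : SimpleGraph V) (S : Finset V) [DecidableEq V] [DecidableRel K.Adj] :
    DecidableRel (coneOpt K S).Adj := fun a b =>
  match a, b with
  | some i, some j => inferInstanceAs (Decidable (K.Adj i j))
  | none, some j => inferInstanceAs (Decidable (j ∈ S))
  | some i, none => inferInstanceAs (Decidable (i ∈ S))
  | none, none => inferInstanceAs (Decidable False)

/-- Old–old adjacency in `coneOpt`. [folklore] -/
@[simp] theorem coneOpt_adj_some_some (K : SimpleGraph V) (S : Finset V) (i j : V) :
    (coneOpt K S).Adj (some i) (some j) ↔ K.Adj i j := Iff.rfl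

/-- New–old adjacency in `coneOpt`. [folklore] -/
@[simp] theorem coneOpt_adj_none_some (K : SimpleGraph V) (S : Finset V) (j : V) :
    (coneOpt K S).Adj none (some j) ↔ j ∈ S := Iff.rfl

/-- Old–new adjacency in `coneOpt`. [folklore] -/
@[simp] theorem coneOpt_adj_some_none (K : SimpleGraph V) (S : Finset V) (i : V) :
    (coneOpt K S).Adj (some i) none ↔ i ∈ S := Iff.rfl

/-- The new vertex carries no loop. [folklore] -/
@[simp] theorem coneOpt_adj_none_none (K : SimpleGraph V) (S : Finset V) :
    (coneOpt K S).Adj none none ↔ False := Iff.rfl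

end Opt

/-! ### 2. The cone graph on `Fin (n + 1)` with the new vertex at position `p` -/

variable {n : ℕ}

/-- **One-vertex extension** `Ext`: the graph on `Fin (n + 1)` obtained from `K` on `Fin n` by placing old vertex `i`
at `p.succAbove i` and a NEW vertex at `p`, joined exactly to (the images of) the vertices in `S`. [folklore] -/
def coneGraph (p : Fin (n + 1)) (K : SimpleGraph (Fin n)) (S : Finset (Fin n)) : SimpleGraph (Fin (n + 1)) :=
  (coneOpt K S).comap (finSuccEquiv' p)

/-- Decidability of adjacency in `coneGraph`. -/
instance coneGraph.decidableRel (p : Fin (n + 1)) (K : SimpleGraph (Fin n)) (S : Finset (Fin n))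
    [DecidableRel K.Adj] : DecidableRel (coneGraph p K S).Adj := fun a b =>
  inferInstanceAs (Decidable ((coneOpt K S).Adj (finSuccEquiv' p a) (finSuccEquiv' p b)))

/-- Adjacency in `coneGraph`, unfolded. [folklore] -/
theorem coneGraph_adj (p : Fin (n + 1)) (K : SimpleGraph (Fin n)) (S : Finset (Fin n)) (a b : Fin (n + 1)) :
    (coneGraph p K S).Adj a b ↔ (coneOpt K S).Adj (finSuccEquiv' p a) (finSuccEquiv' p b) := Iff.rfl

/-- Old–old adjacency in the cone graph is adjacency in `K`. [folklore] -/
@[simp] theorem coneGraph_adj_succAbove_succAbove (p : Fin (n + 1)) (K : SimpleGraph (Fin n)) (S : Finset (Fin n))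
    (i j : Fin n) : (coneGraph p K S).Adj (p.succAbove i) (p.succAbove j) ↔ K.Adj i j := by
  rw [coneGraph_adj, finSuccEquiv'_succAbove, finSuccEquiv'_succAbove, coneOpt_adj_some_some]

/-- The new vertex `p` is adjacent to the old vertex `i` iff `i ∈ S`. [folklore] -/
@[simp] theorem coneGraph_adj_self_succAbove (p : Fin (n + 1)) (K : SimpleGraph (Fin n)) (S : Finset (Fin n))
    (j : Fin n) : (coneGraph p K S).Adj p (p.succAbove j) ↔ j ∈ S := by
  rw [coneGraph_adj, finSuccEquiv'_at, finSuccEquiv'_succAbove, coneOpt_adj_none_some]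

/-- The old vertex `i` is adjacent to the new vertex `p` iff `i ∈ S`. [folklore] -/
@[simp] theorem coneGraph_adj_succAbove_self (p : Fin (n + 1)) (K : SimpleGraph (Fin n)) (S : Finset (Fin n))
    (i : Fin n) : (coneGraph p K S).Adj (p.succAbove i) p ↔ i ∈ S := by
  rw [coneGraph_adj, finSuccEquiv'_at, finSuccEquiv'_succAbove, coneOpt_adj_some_none]

/-- Deleting the new vertex of the cone graph gives back `K`. [folklore] -/
@[simp] theorem comap_coneGraph_succAbove (p : Fin (n + 1)) (K : SimpleGraph (Fin n)) (S : Finset (Fin n)) :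
    (coneGraph p K S).comap p.succAbove = K := by
  ext i j
  rw [comap_adj, coneGraph_adj_succAbove_succAbove]

/-- The neighbours of the new vertex are the images of `S`. [folklore] -/
theorem neighborFinset_coneGraph_self (p : Fin (n + 1)) (K : SimpleGraph (Fin n)) (S : Finset (Fin n))
    [DecidableRel K.Adj] : (coneGraph p K S).neighborFinset p = S.map p.succAboveEmb := by
  ext a
  rw [mem_neighborFinset, Finset.mem_map]
  constructor
  · intro h
    rcases Fin.eq_self_or_eq_succAbove p a with rfl | ⟨j, rfl⟩
    · exact absurd h (SimpleGraph.irrefl _)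
    · exact ⟨j, (coneGraph_adj_self_succAbove p K S j).1 h, rfl⟩
  · rintro ⟨j, hj, rfl⟩
    exact (coneGraph_adj_self_succAbove p K S j).2 hj

/-- **The new vertex has degree `|S|`.** [folklore] -/
theorem degree_coneGraph_self (p : Fin (n + 1)) (K : SimpleGraph (Fin n)) (S : Finset (Fin n))
    [DecidableRel K.Adj] : (coneGraph p K S).degree p = S.card := by
  rw [← card_neighborFinset_eq_degree, neighborFinset_coneGraph_self, Finset.card_map]

/-- The neighbours of an old vertex: its old neighbours, plus the new vertex if it lies in `S`. [folklore] -/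
theorem neighborFinset_coneGraph_succAbove (p : Fin (n + 1)) (K : SimpleGraph (Fin n)) (S : Finset (Fin n))
    [DecidableRel K.Adj] (i : Fin n) :
    (coneGraph p K S).neighborFinset (p.succAbove i) =
      (K.neighborFinset i).map p.succAboveEmb ∪ (if i ∈ S then {p} else ∅) := by
  ext a
  rw [mem_neighborFinset, Finset.mem_union, Finset.mem_map]
  constructor
  · intro h
    rcases Fin.eq_self_or_eq_succAbove p a with rfl | ⟨j, rfl⟩
    · right
      rw [if_pos ((coneGraph_adj_succAbove_self _ K S i).1 h)]
      exact Finset.mem_singleton_self _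
    · exact Or.inl ⟨j, (mem_neighborFinset _ _ _).2 ((coneGraph_adj_succAbove_succAbove p K S i j).1 h), rfl⟩
  · rintro (⟨j, hj, rfl⟩ | h)
    · exact (coneGraph_adj_succAbove_succAbove p K S i j).2 ((mem_neighborFinset _ _ _).1 hj)
    · split_ifs at h with hi
      · rw [Finset.mem_singleton] at h
        subst h
        exact (coneGraph_adj_succAbove_self _ K S i).2 hi
      · exact absurd h (Finset.notMem_empty a)

/-- **An old vertex keeps its degree, plus one if it is joined to the new vertex.** [folklore] -/
theorem degree_coneGraph_succAbove (p : Fin (n + 1)) (K : SimpleGraph (Fin n)) (S : Finset (Fin n))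
    [DecidableRel K.Adj] (i : Fin n) :
    (coneGraph p K S).degree (p.succAbove i) = K.degree i + (if i ∈ S then 1 else 0) := by
  rw [← card_neighborFinset_eq_degree, ← card_neighborFinset_eq_degree, neighborFinset_coneGraph_succAbove,
    Finset.card_union_of_disjoint, Finset.card_map]
  · split_ifs <;> simp
  · rw [Finset.disjoint_left]
    rintro a ha hb
    obtain ⟨j, -, rfl⟩ := Finset.mem_map.1 ha
    split_ifs at hb
    · exact Fin.succAbove_ne p j (Finset.mem_singleton.1 hb)
    · exact Finset.notMem_empty _ hb

/-- **The cone adds exactly `|S|` edges:** `|E(coneGraph p K S)| = |E(K)| + |S|`. [folklore] -/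
theorem card_edgeFinset_coneGraph (p : Fin (n + 1)) (K : SimpleGraph (Fin n)) (S : Finset (Fin n))
    [DecidableRel K.Adj] : (coneGraph p K S).edgeFinset.card = K.edgeFinset.card + S.card := by
  have h1 := (coneGraph p K S).sum_degrees_eq_twice_card_edges
  have h2 := K.sum_degrees_eq_twice_card_edges
  rw [Fin.sum_univ_succAbove _ p, degree_coneGraph_self] at h1
  simp only [degree_coneGraph_succAbove, Finset.sum_add_distrib, Finset.sum_ite_mem, Finset.univ_inter,
    Finset.sum_const, smul_eq_mul, mul_one] at h1
  omega

/-! ### 3. Every graph is a cone over each of its vertex-deleted subgraphs -/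

/-- The old neighbours of `p` in `G`, as a subset of `Fin n` (old vertex `i` = `p.succAbove i`). [folklore] -/
def linkBelow (G : SimpleGraph (Fin (n + 1))) [DecidableRel G.Adj] (p : Fin (n + 1)) : Finset (Fin n) :=
  Finset.univ.filter fun i => G.Adj p (p.succAbove i)

/-- Membership in `linkBelow`. [folklore] -/
@[simp] theorem mem_linkBelow (G : SimpleGraph (Fin (n + 1))) [DecidableRel G.Adj] (p : Fin (n + 1)) (i : Fin n) :
    i ∈ linkBelow G p ↔ G.Adj p (p.succAbove i) := by
  simp [linkBelow]

/-- The neighbours of `p` are the images of `linkBelow G p`. [folklore] -/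
theorem neighborFinset_eq_map_linkBelow (G : SimpleGraph (Fin (n + 1))) [DecidableRel G.Adj] (p : Fin (n + 1)) :
    G.neighborFinset p = (linkBelow G p).map p.succAboveEmb := by
  ext a
  rw [mem_neighborFinset, Finset.mem_map]
  constructor
  · intro h
    rcases Fin.eq_self_or_eq_succAbove p a with rfl | ⟨j, rfl⟩
    · exact absurd h (SimpleGraph.irrefl _)
    · exact ⟨j, (mem_linkBelow G p j).2 h, rfl⟩
  · rintro ⟨j, hj, rfl⟩
    exact (mem_linkBelow G p j).1 hj

/-- `|linkBelow G p| = deg p`. [folklore] -/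
theorem card_linkBelow (G : SimpleGraph (Fin (n + 1))) [DecidableRel G.Adj] (p : Fin (n + 1)) :
    (linkBelow G p).card = G.degree p := by
  rw [← card_neighborFinset_eq_degree, neighborFinset_eq_map_linkBelow, Finset.card_map]

/-- **Every graph is a cone (Lemma R6, combinatorial core).** For any graph `G` on `Fin (n + 1)`, any vertex `p`,
any isomorphism `φ` from the vertex-deleted graph `G.comap p.succAbove` onto a graph `H`, and any position `q`,
`G` is isomorphic to the cone over `H` with the new vertex at `q` joined to `φ '' linkBelow G p`. [folklore] -/
def isoConeGraph (G : SimpleGraph (Fin (n + 1))) [DecidableRel G.Adj] (p : Fin (n + 1)) {H : SimpleGraph (Fin n)}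
    (φ : G.comap p.succAbove ≃g H) (q : Fin (n + 1)) :
    G ≃g coneGraph q H ((linkBelow G p).map φ.toEquiv.toEmbedding) where
  toEquiv := (finSuccEquiv' p).trans ((Equiv.optionCongr φ.toEquiv).trans (finSuccEquiv' q).symm)
  map_rel_iff' := by
    intro a b
    simp only [Equiv.trans_apply, coneGraph_adj, Equiv.apply_symm_apply, Equiv.optionCongr_apply]
    induction a using p.succAboveCases <;> induction b using p.succAboveCases
    · simp only [finSuccEquiv'_at, Option.map_none, SimpleGraph.irrefl]
    · rename_i j
      simp only [finSuccEquiv'_at, finSuccEquiv'_succAbove, Option.map_none, Option.map_some, coneOpt_adj_none_some,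
        Finset.mem_map_equiv, mem_linkBelow]
      erw [Equiv.symm_apply_apply]
    · rename_i i
      simp only [finSuccEquiv'_at, finSuccEquiv'_succAbove, Option.map_none, Option.map_some, coneOpt_adj_some_none,
        Finset.mem_map_equiv, mem_linkBelow]
      erw [Equiv.symm_apply_apply]
      rw [adj_comm]
    · rename_i i j
      simp only [finSuccEquiv'_succAbove, Option.map_some, coneOpt_adj_some_some]
      exact φ.map_rel_iff'

/-- The underlying map of `isoConeGraph`. -/
@[simp] theorem isoConeGraph_apply (G : SimpleGraph (Fin (n + 1))) [DecidableRel G.Adj] (p : Fin (n + 1))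
    {H : SimpleGraph (Fin n)} (φ : G.comap p.succAbove ≃g H) (q : Fin (n + 1)) (a : Fin (n + 1)) :
    isoConeGraph G p φ q a = (finSuccEquiv' q).symm (Option.map φ (finSuccEquiv' p a)) := rfl

/-- In particular `G = Ext(G − p ⊕ N(p))` on the nose: `G` is the cone over `G.comap p.succAbove` at `p`.
[folklore] -/
theorem eq_coneGraph (G : SimpleGraph (Fin (n + 1))) [DecidableRel G.Adj] (p : Fin (n + 1)) :
    G = coneGraph p (G.comap p.succAbove) (linkBelow G p) := by
  ext a b
  induction a using p.succAboveCases <;> induction b using p.succAboveCases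
  · simp only [SimpleGraph.irrefl]
  · rename_i j
    rw [coneGraph_adj_self_succAbove, mem_linkBelow]
  · rename_i i
    rw [coneGraph_adj_succAbove_self, mem_linkBelow, adj_comm]
  · rename_i i j
    rw [coneGraph_adj_succAbove_succAbove, comap_adj]

/-! ### 4. Vertex deletion: degrees and edge count -/

/-- Decidability of adjacency in `G.comap f` from that of `G`. -/
instance comapDecidableRel {V W : Type*} (G : SimpleGraph W) [DecidableRel G.Adj] (f : V → W) :
    DecidableRel (G.comap f).Adj := fun a b => inferInstanceAs (Decidable (G.Adj (f a) (f b)))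

/-- Deleting `p`: the neighbours of a remaining vertex are its old neighbours other than `p`. [folklore] -/
theorem map_neighborFinset_comap_succAbove (G : SimpleGraph (Fin (n + 1))) [DecidableRel G.Adj] (p : Fin (n + 1))
    (i : Fin n) :
    ((G.comap p.succAbove).neighborFinset i).map p.succAboveEmb = (G.neighborFinset (p.succAbove i)).erase p := by
  ext a
  simp only [Finset.mem_map, mem_neighborFinset, comap_adj, Finset.mem_erase, Fin.coe_succAboveEmb]
  constructor
  · rintro ⟨j, hj, rfl⟩
    exact ⟨Fin.succAbove_ne p j, hj⟩
  · rintro ⟨ha, hadj⟩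
    obtain ⟨j, rfl⟩ := Fin.exists_succAbove_eq ha
    exact ⟨j, hadj, rfl⟩

/-- **Deleting `p` costs each other vertex at most one edge:**
`deg_{G − p}(i) + [p ∼ i] = deg_G(i)`. [folklore] -/
theorem degree_comap_succAbove_add (G : SimpleGraph (Fin (n + 1))) [DecidableRel G.Adj] (p : Fin (n + 1))
    (i : Fin n) :
    (G.comap p.succAbove).degree i + (if G.Adj p (p.succAbove i) then 1 else 0) = G.degree (p.succAbove i) := by
  rw [← card_neighborFinset_eq_degree, ← card_neighborFinset_eq_degree,
    ← Finset.card_map p.succAboveEmb, map_neighborFinset_comap_succAbove]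
  by_cases h : G.Adj p (p.succAbove i)
  · rw [if_pos h]
    exact Finset.card_erase_add_one ((mem_neighborFinset _ _ _).2 h.symm)
  · rw [if_neg h, add_zero, Finset.erase_eq_of_notMem]
    exact fun hm => h ((mem_neighborFinset _ _ _).1 hm).symm

/-- Hence `deg_G(i) − 1 ≤ deg_{G − p}(i)` for every remaining vertex. [folklore] -/
theorem degree_sub_one_le_degree_comap_succAbove (G : SimpleGraph (Fin (n + 1))) [DecidableRel G.Adj]
    (p : Fin (n + 1)) (i : Fin n) : G.degree (p.succAbove i) - 1 ≤ (G.comap p.succAbove).degree i := by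
  have h := degree_comap_succAbove_add G p i
  split_ifs at h <;> omega

/-- **Edge count under vertex deletion:** `|E(G − p)| + deg_G(p) = |E(G)|`. [folklore] -/
theorem card_edgeFinset_comap_succAbove_add_degree (G : SimpleGraph (Fin (n + 1))) [DecidableRel G.Adj]
    (p : Fin (n + 1)) : (G.comap p.succAbove).edgeFinset.card + G.degree p = G.edgeFinset.card := by
  have h1 := G.sum_degrees_eq_twice_card_edges
  have h2 := (G.comap p.succAbove).sum_degrees_eq_twice_card_edges
  have h3 := card_linkBelow G p
  rw [Fin.sum_univ_succAbove _ p] at h1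
  simp only [← degree_comap_succAbove_add G p, Finset.sum_add_distrib, Finset.sum_boole, Nat.cast_id] at h1
  rw [linkBelow] at h3
  omega

/-- So a vertex's degree never exceeds the number of edges, and `|E(G − p)| = |E(G)| − deg p`. [folklore] -/
theorem card_edgeFinset_comap_succAbove (G : SimpleGraph (Fin (n + 1))) [DecidableRel G.Adj] (p : Fin (n + 1)) :
    (G.comap p.succAbove).edgeFinset.card = G.edgeFinset.card - G.degree p := by
  have h := card_edgeFinset_comap_succAbove_add_degree G p
  omega

end Summit.Ventures.Crystal3D
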